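import Summits.QuantumFields.BalabanUV.Beta.GAN24.ForcingFacePairFormAssembly
import Summits.QuantumFields.BalabanUV.Beta.GAN24.CrossedFromThreeWords
import Summits.QuantumFields.BalabanUV.Beta.GAN24.WSlotT2OfPieces

/-!
# `BalabanUV.Beta.GAN24.FaceReadCrossedFromValues` — binder row G-an2-4 ∕ (CONV-C), W-slot (α-0), typer's PART VI row **T6-VAL**, the (γ) hand's letters **K7-a ∕ K7-0, THE ADAPTER FOR
# road-P2's LITERAL AT ANY LEVEL `j`, VALUES AS INPUTS**: leaf-02 Part 50c `ForcingFacePairFormAssembly.forcingPairForm_dressedStep`'s LITERAL `LS`-symmetrised period-`P` face read of the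
# level-`j` dressed source `c • mmRead Lc (K3OfK X̃♮ⱼ Lc S M W) + cB • B` (generic stencil table `S` with locality, `Lc`-block periodicity and F5 rows; `M`, `W = W2SymOfK … 0 M₂`, `B` as
# there) at the crossed pattern `(a₀b₀;a₀b₀)`, WITHOUT Part 50c's `hL ∕ hR`, GIVEN the eight fine-word values of `S` at the deep period `Lc·P` (direct `(b₀a₀;a₀b₀) = V₁`, `(a₀b₀;b₀a₀) = V₂`,
# direct zero on `(a₀b₀;a₀b₀)`, `(b₀a₀;b₀a₀)`; swapped `(a₀b₀;a₀b₀) = V₁`, `(b₀a₀;b₀a₀) = V₂`, swapped zero on `(b₀a₀;a₀b₀)`, `(a₀b₀;b₀a₀)`), EQUALS `4·(c·(−Kⱼ²))·Kⱼ²·(V₁ + V₂)`,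
# `Kⱼ = sf·sm·(stepScale d Lc j·Lc^{d+1})⁻¹`.  Instances: level 0 with the FULL table = `FaceReadCrossedValueZero` (values by `FaceWordFullZero(Patterns)`); levels `≥ 1` with the FULL
# table at the W-locus pins = this + `FaceWordFullDeepPatterns` ∕ `FaceWordFullDeep` (eight values GREEN there)
# (G-an2-4 CRUX TEAM (2), seat `b2b-balaban-gan24-formalise-leaf-06` = the (γ) hand, gen 57; journal [GAN24LEAF06-G57-INTENT-8])

NOT IN PRINT; OUR PROOF ([folklore] bookkeeping: the text IS leaf-02 Part 50c's proof with Part 49 replaced by `CrossedFromThreeWords.crossed_of_threeWords`; leaf-02 Parts 44a∕45∕46∕47∕50b BY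
NAME; 0 `def`, 0 cited fact, 0 `def … : Prop`, 0 sorry).  HONEST FRAMING (cell contract, verbatim): «discharging `BetaPertH` makes Bałaban's UV stability UNCONDITIONAL — a real
constructive-QFT result; it is NOT the continuum limit and NOT the Clay problem.»  HONEST DEPENDENCY (verbatim): «continuum YM on T⁴ ⇐ BetaPertH ∧ nine spine estimates (0/9 proved); BetaPertH
⇐ (D1) ∧ (D4) ∧ CAP+tail; G-an2-4 gates asym, D1 and NE2/3/4.»  All eight values are HYPOTHESES; F5 rows `hSrow ∕ hMrow` HYPOTHESES; NOT `hXu`; discharges NOTHING of `hX` ∕ (C) ∕ `hB0` ∕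
`hBF` ∕ (Q-L); NEVER «G-an2-4 closed» as (CONV-C); NOT D1, NOT `BetaPertH`, NOT continuum, NOT Clay.  2026-08-24; no existing file touched.
v1.1 (leaf-06 g58): `set_option maxHeartbeats 400000 in` before the one theorem (same text as (Q), same heartbeat margin); statement and proof byte-identical to v1.
v1.2 (leaf-06 g58): `WSlotT2OfPieces.locStencil₂_zero` BY NAME instead of 50c's `locStencil₂_zero'` twin (import added); statement and proof otherwise byte-identical.
-/

noncomputable section

open Finset
open scoped BigOperators
open Literature.MathematicalPhysics.QuantumFieldTheory
open Literature.MathematicalPhysics.QuantumFieldTheory.Balaban1983to89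
open Literature.MathematicalPhysics.QuantumFieldTheory.Balaban1983to89.Beta
open B12Sec2to5 (l1)
open ExpKernelCalculus (Site MKer Decays BiLoc VertexFamily VertexFamily₂ shiftK comp)
open OneStepResolventKernel (Fib LocStencil biLoc_mono)
open BalabanCompositeJets (LocStencil₂)
open AffineAveraging (box toSite)
open OneStepKernelFamily (KInvStep decays_KInvStep shiftK_KInvStep)
open SecondOrderResponse (dM K2OfK W2SymOfK LocStencilFM vertexFamily₂_W2SymOfK')
open BalabanStepW2 (K3OfK)
open BalabanStepJetsSucc (mmRead)
open BalabanStepJets (locStencil_mono)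
open Summit.QuantumFields.BalabanUV.Beta.TameKernelCalculus (Loc trK)
open Summit.QuantumFields.BalabanUV.Beta.BorderedHessian (stepScale sgnK)
open Summit.QuantumFields.BalabanUV.Beta.AxialDressingRooted (coDressKBmAt shiftK_coDressKBmAt decays_coDressKBmAt)
open Summit.QuantumFields.BalabanUV.Beta.HessKerDressedUnits (unitK decays_unitK)
open Summit.QuantumFields.BalabanUV.Beta.GAN24.BiStencilZeroMode (Tab)
open Summit.QuantumFields.BalabanUV.Beta.GAN24.FaceWordsDeepCurrents (summable_word_coarse summable_word_coarse_right)
open Summit.QuantumFields.BalabanUV.Beta.GAN24.DressedVertexFacePush (tsum_faceBond_dM_dressedStep exists_vertexFamily_dM_dressedStep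
  dM_dressedStep_translate_coarse)
open Summit.QuantumFields.BalabanUV.Beta.GAN24.FourFaceSourceWordsDeep (faceRead_dressedSource_inl_inl)
open Summit.QuantumFields.BalabanUV.Beta.GAN24.FaceWWordLetters (locStencilFM_mono)
open Summit.QuantumFields.BalabanUV.Beta.GAN24.FaceWWordSummable (summable_faceWord_W2SymOfK_zero₂)
open Summit.QuantumFields.BalabanUV.Beta.GAN24.FaceWWordVanishing (faceWWord_LS_eq_zero)
open Summit.QuantumFields.BalabanUV.Beta.GAN24.ForcingFacePairFormAssembly (ite_and_three)
open Summit.QuantumFields.BalabanUV.Beta.GAN24.CrossedFromThreeWords (crossed_of_threeWords)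

namespace Summit.QuantumFields.BalabanUV.Beta.GAN24.FaceReadCrossedFromValues

variable {d : ℕ} {Lc : ℕ} [NeZero Lc] {r : Fin (d + 1) → ℕ}

set_option maxHeartbeats 400000 in
/-- NOT IN PRINT; OUR PROOF.  **THE CROSSED VALUE OF THE LEVEL-`j` FORCING's FACE READ FROM THE EIGHT FINE-WORD VALUES** (module docstring). -/
theorem crossed_faceRead_of_values (hLc : 1 ≤ Lc) (hr : r ∈ box (d + 1) Lc) {P : ℕ} (hP : 1 ≤ P) (sf sm : ℝ) (j : ℕ)
    {S M : Fin (d + 1) → Site (d + 1) → MKer (d + 1) (Fib d)} {Cs δs CM δM : ℝ}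
    (hS : LocStencil S Cs δs) (hδs : 0 < δs) (hM : VertexFamily M Lc CM δM) (hδM : 0 < δM)
    (hSt : ∀ (κ : Fin (d + 1)) (u t : Site (d + 1)), S κ (u + (Lc : ℤ) • t) = shiftK (-((Lc : ℤ) • t)) (S κ u))
    (hMt : ∀ (ρ : Fin (d + 1)) (w t : Site (d + 1)), M ρ (w + t) = shiftK (-((Lc : ℤ) • t)) (M ρ w))
    (hSrow : ∀ κ u, trK (S κ u) = -sgnK (S κ u)) (hMrow : ∀ ρ w, trK (M ρ w) = -sgnK (M ρ w))
    {M₂ : Fin (d + 1) → Site (d + 1) → Fin (d + 1) → Site (d + 1) → MKer (d + 1) (Fib d)} {C₂ δ₂ : ℝ} (hM₂ : LocStencilFM Lc M₂ C₂ δ₂) (hδ₂ : 0 < δ₂)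
    (hM₂t : ∀ (κ : Fin (d + 1)) (u : Site (d + 1)) (ρ : Fin (d + 1)) (w t : Site (d + 1)), M₂ κ (u + (Lc : ℤ) • t) ρ (w + t) = shiftK (-((Lc : ℤ) • t)) (M₂ κ u ρ w))
    {B : Tab d} (hBff : ∀ κ u κ' u' x z (α β : Fin (d + 1)), B κ u κ' u' x z (Sum.inl α) (Sum.inl β) = 0) (c cB : ℝ)
    {a₀ b₀ : Fin (d + 1)} {V₁ V₂ : ℝ}
    (hD1 : (∑ rr ∈ box (d + 1) (Lc * P), ∑' t : Site (d + 1), (if toSite rr b₀ % ((Lc * P : ℕ) : ℤ) = ((Lc * P : ℕ) : ℤ) - 1 then (1 : ℝ) else 0) * (if t a₀ % ((Lc * P : ℕ) : ℤ) = ((Lc * P : ℕ) : ℤ) - 1 then (1 : ℝ) else 0) *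
        ∑' yw : Site (d + 1) × Site (d + 1), ((if yw.1 a₀ % ((Lc * P : ℕ) : ℤ) = ((Lc * P : ℕ) : ℤ) - 1 then (1 : ℝ) else 0) * (if yw.2 b₀ % ((Lc * P : ℕ) : ℤ) = ((Lc * P : ℕ) : ℤ) - 1 then (1 : ℝ) else 0)) *
          comp (comp (S b₀ (toSite rr)) (unitK sf sm (coDressKBmAt (toSite r) Lc (KInvStep (d := d) Lc j)))) (S a₀ t) yw.1 yw.2 (Sum.inl a₀) (Sum.inl b₀)) = V₁)
    (hD2 : (∑ rr ∈ box (d + 1) (Lc * P), ∑' t : Site (d + 1), (if toSite rr a₀ % ((Lc * P : ℕ) : ℤ) = ((Lc * P : ℕ) : ℤ) - 1 then (1 : ℝ) else 0) * (if t b₀ % ((Lc * P : ℕ) : ℤ) = ((Lc * P : ℕ) : ℤ) - 1 then (1 : ℝ) else 0) *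
        ∑' yw : Site (d + 1) × Site (d + 1), ((if yw.1 b₀ % ((Lc * P : ℕ) : ℤ) = ((Lc * P : ℕ) : ℤ) - 1 then (1 : ℝ) else 0) * (if yw.2 a₀ % ((Lc * P : ℕ) : ℤ) = ((Lc * P : ℕ) : ℤ) - 1 then (1 : ℝ) else 0)) *
          comp (comp (S a₀ (toSite rr)) (unitK sf sm (coDressKBmAt (toSite r) Lc (KInvStep (d := d) Lc j)))) (S b₀ t) yw.1 yw.2 (Sum.inl b₀) (Sum.inl a₀)) = V₂)
    (hD3 : (∑ rr ∈ box (d + 1) (Lc * P), ∑' t : Site (d + 1), (if toSite rr a₀ % ((Lc * P : ℕ) : ℤ) = ((Lc * P : ℕ) : ℤ) - 1 then (1 : ℝ) else 0) * (if t b₀ % ((Lc * P : ℕ) : ℤ) = ((Lc * P : ℕ) : ℤ) - 1 then (1 : ℝ) else 0) *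
        ∑' yw : Site (d + 1) × Site (d + 1), ((if yw.1 a₀ % ((Lc * P : ℕ) : ℤ) = ((Lc * P : ℕ) : ℤ) - 1 then (1 : ℝ) else 0) * (if yw.2 b₀ % ((Lc * P : ℕ) : ℤ) = ((Lc * P : ℕ) : ℤ) - 1 then (1 : ℝ) else 0)) *
          comp (comp (S a₀ (toSite rr)) (unitK sf sm (coDressKBmAt (toSite r) Lc (KInvStep (d := d) Lc j)))) (S b₀ t) yw.1 yw.2 (Sum.inl a₀) (Sum.inl b₀)) = 0)
    (hD4 : (∑ rr ∈ box (d + 1) (Lc * P), ∑' t : Site (d + 1), (if toSite rr b₀ % ((Lc * P : ℕ) : ℤ) = ((Lc * P : ℕ) : ℤ) - 1 then (1 : ℝ) else 0) * (if t a₀ % ((Lc * P : ℕ) : ℤ) = ((Lc * P : ℕ) : ℤ) - 1 then (1 : ℝ) else 0) *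
        ∑' yw : Site (d + 1) × Site (d + 1), ((if yw.1 b₀ % ((Lc * P : ℕ) : ℤ) = ((Lc * P : ℕ) : ℤ) - 1 then (1 : ℝ) else 0) * (if yw.2 a₀ % ((Lc * P : ℕ) : ℤ) = ((Lc * P : ℕ) : ℤ) - 1 then (1 : ℝ) else 0)) *
          comp (comp (S b₀ (toSite rr)) (unitK sf sm (coDressKBmAt (toSite r) Lc (KInvStep (d := d) Lc j)))) (S a₀ t) yw.1 yw.2 (Sum.inl b₀) (Sum.inl a₀)) = 0)
    (hS1 : (∑ rr ∈ box (d + 1) (Lc * P), ∑' t : Site (d + 1), (if toSite rr a₀ % ((Lc * P : ℕ) : ℤ) = ((Lc * P : ℕ) : ℤ) - 1 then (1 : ℝ) else 0) * (if t b₀ % ((Lc * P : ℕ) : ℤ) = ((Lc * P : ℕ) : ℤ) - 1 then (1 : ℝ) else 0) *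
        ∑' yw : Site (d + 1) × Site (d + 1), ((if yw.1 a₀ % ((Lc * P : ℕ) : ℤ) = ((Lc * P : ℕ) : ℤ) - 1 then (1 : ℝ) else 0) * (if yw.2 b₀ % ((Lc * P : ℕ) : ℤ) = ((Lc * P : ℕ) : ℤ) - 1 then (1 : ℝ) else 0)) *
          comp (comp (S b₀ t) (unitK sf sm (coDressKBmAt (toSite r) Lc (KInvStep (d := d) Lc j)))) (S a₀ (toSite rr)) yw.1 yw.2 (Sum.inl a₀) (Sum.inl b₀)) = V₁)
    (hS2 : (∑ rr ∈ box (d + 1) (Lc * P), ∑' t : Site (d + 1), (if toSite rr b₀ % ((Lc * P : ℕ) : ℤ) = ((Lc * P : ℕ) : ℤ) - 1 then (1 : ℝ) else 0) * (if t a₀ % ((Lc * P : ℕ) : ℤ) = ((Lc * P : ℕ) : ℤ) - 1 then (1 : ℝ) else 0) *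
        ∑' yw : Site (d + 1) × Site (d + 1), ((if yw.1 b₀ % ((Lc * P : ℕ) : ℤ) = ((Lc * P : ℕ) : ℤ) - 1 then (1 : ℝ) else 0) * (if yw.2 a₀ % ((Lc * P : ℕ) : ℤ) = ((Lc * P : ℕ) : ℤ) - 1 then (1 : ℝ) else 0)) *
          comp (comp (S a₀ t) (unitK sf sm (coDressKBmAt (toSite r) Lc (KInvStep (d := d) Lc j)))) (S b₀ (toSite rr)) yw.1 yw.2 (Sum.inl b₀) (Sum.inl a₀)) = V₂)
    (hS3 : (∑ rr ∈ box (d + 1) (Lc * P), ∑' t : Site (d + 1), (if toSite rr b₀ % ((Lc * P : ℕ) : ℤ) = ((Lc * P : ℕ) : ℤ) - 1 then (1 : ℝ) else 0) * (if t a₀ % ((Lc * P : ℕ) : ℤ) = ((Lc * P : ℕ) : ℤ) - 1 then (1 : ℝ) else 0) *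
        ∑' yw : Site (d + 1) × Site (d + 1), ((if yw.1 a₀ % ((Lc * P : ℕ) : ℤ) = ((Lc * P : ℕ) : ℤ) - 1 then (1 : ℝ) else 0) * (if yw.2 b₀ % ((Lc * P : ℕ) : ℤ) = ((Lc * P : ℕ) : ℤ) - 1 then (1 : ℝ) else 0)) *
          comp (comp (S a₀ t) (unitK sf sm (coDressKBmAt (toSite r) Lc (KInvStep (d := d) Lc j)))) (S b₀ (toSite rr)) yw.1 yw.2 (Sum.inl a₀) (Sum.inl b₀)) = 0)
    (hS4 : (∑ rr ∈ box (d + 1) (Lc * P), ∑' t : Site (d + 1), (if toSite rr a₀ % ((Lc * P : ℕ) : ℤ) = ((Lc * P : ℕ) : ℤ) - 1 then (1 : ℝ) else 0) * (if t b₀ % ((Lc * P : ℕ) : ℤ) = ((Lc * P : ℕ) : ℤ) - 1 then (1 : ℝ) else 0) *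
        ∑' yw : Site (d + 1) × Site (d + 1), ((if yw.1 b₀ % ((Lc * P : ℕ) : ℤ) = ((Lc * P : ℕ) : ℤ) - 1 then (1 : ℝ) else 0) * (if yw.2 a₀ % ((Lc * P : ℕ) : ℤ) = ((Lc * P : ℕ) : ℤ) - 1 then (1 : ℝ) else 0)) *
          comp (comp (S b₀ t) (unitK sf sm (coDressKBmAt (toSite r) Lc (KInvStep (d := d) Lc j)))) (S a₀ (toSite rr)) yw.1 yw.2 (Sum.inl b₀) (Sum.inl a₀)) = 0) :
        ((fun μ ν α β : Fin (d + 1) => ∑ r' ∈ box (d + 1) P, ∑' u' : Site (d + 1), ∑' x : Site (d + 1), ∑' z : Site (d + 1),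
            (if toSite r' μ % (P : ℤ) = (P : ℤ) - 1 ∧ u' ν % (P : ℤ) = (P : ℤ) - 1 ∧ x α % (P : ℤ) = (P : ℤ) - 1 ∧ z β % (P : ℤ) = (P : ℤ) - 1 then
              (c • mmRead Lc (K3OfK (unitK sf sm (coDressKBmAt (toSite r) Lc (KInvStep (d := d) Lc j))) Lc S M
                  (W2SymOfK (unitK sf sm (coDressKBmAt (toSite r) Lc (KInvStep (d := d) Lc j))) Lc S M 0 M₂) μ (toSite r') ν u')
                + cB • B μ (toSite r') ν u') x z (Sum.inl α) (Sum.inl β) else 0)) a₀ b₀ a₀ b₀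
          + (fun μ ν α β : Fin (d + 1) => ∑ r' ∈ box (d + 1) P, ∑' u' : Site (d + 1), ∑' x : Site (d + 1), ∑' z : Site (d + 1),
            (if toSite r' μ % (P : ℤ) = (P : ℤ) - 1 ∧ u' ν % (P : ℤ) = (P : ℤ) - 1 ∧ x α % (P : ℤ) = (P : ℤ) - 1 ∧ z β % (P : ℤ) = (P : ℤ) - 1 then
              (c • mmRead Lc (K3OfK (unitK sf sm (coDressKBmAt (toSite r) Lc (KInvStep (d := d) Lc j))) Lc S M
                  (W2SymOfK (unitK sf sm (coDressKBmAt (toSite r) Lc (KInvStep (d := d) Lc j))) Lc S M 0 M₂) μ (toSite r') ν u')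
                + cB • B μ (toSite r') ν u') x z (Sum.inl α) (Sum.inl β) else 0)) b₀ a₀ a₀ b₀)
        + ((fun μ ν α β : Fin (d + 1) => ∑ r' ∈ box (d + 1) P, ∑' u' : Site (d + 1), ∑' x : Site (d + 1), ∑' z : Site (d + 1),
            (if toSite r' μ % (P : ℤ) = (P : ℤ) - 1 ∧ u' ν % (P : ℤ) = (P : ℤ) - 1 ∧ x α % (P : ℤ) = (P : ℤ) - 1 ∧ z β % (P : ℤ) = (P : ℤ) - 1 then
              (c • mmRead Lc (K3OfK (unitK sf sm (coDressKBmAt (toSite r) Lc (KInvStep (d := d) Lc j))) Lc S M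
                  (W2SymOfK (unitK sf sm (coDressKBmAt (toSite r) Lc (KInvStep (d := d) Lc j))) Lc S M 0 M₂) μ (toSite r') ν u')
                + cB • B μ (toSite r') ν u') x z (Sum.inl α) (Sum.inl β) else 0)) b₀ a₀ a₀ b₀
          + (fun μ ν α β : Fin (d + 1) => ∑ r' ∈ box (d + 1) P, ∑' u' : Site (d + 1), ∑' x : Site (d + 1), ∑' z : Site (d + 1),
            (if toSite r' μ % (P : ℤ) = (P : ℤ) - 1 ∧ u' ν % (P : ℤ) = (P : ℤ) - 1 ∧ x α % (P : ℤ) = (P : ℤ) - 1 ∧ z β % (P : ℤ) = (P : ℤ) - 1 then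
              (c • mmRead Lc (K3OfK (unitK sf sm (coDressKBmAt (toSite r) Lc (KInvStep (d := d) Lc j))) Lc S M
                  (W2SymOfK (unitK sf sm (coDressKBmAt (toSite r) Lc (KInvStep (d := d) Lc j))) Lc S M 0 M₂) μ (toSite r') ν u')
                + cB • B μ (toSite r') ν u') x z (Sum.inl α) (Sum.inl β) else 0)) a₀ b₀ a₀ b₀)
        + (((fun μ ν α β : Fin (d + 1) => ∑ r' ∈ box (d + 1) P, ∑' u' : Site (d + 1), ∑' x : Site (d + 1), ∑' z : Site (d + 1),
            (if toSite r' μ % (P : ℤ) = (P : ℤ) - 1 ∧ u' ν % (P : ℤ) = (P : ℤ) - 1 ∧ x α % (P : ℤ) = (P : ℤ) - 1 ∧ z β % (P : ℤ) = (P : ℤ) - 1 then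
              (c • mmRead Lc (K3OfK (unitK sf sm (coDressKBmAt (toSite r) Lc (KInvStep (d := d) Lc j))) Lc S M
                  (W2SymOfK (unitK sf sm (coDressKBmAt (toSite r) Lc (KInvStep (d := d) Lc j))) Lc S M 0 M₂) μ (toSite r') ν u')
                + cB • B μ (toSite r') ν u') x z (Sum.inl α) (Sum.inl β) else 0)) a₀ b₀ b₀ a₀
          + (fun μ ν α β : Fin (d + 1) => ∑ r' ∈ box (d + 1) P, ∑' u' : Site (d + 1), ∑' x : Site (d + 1), ∑' z : Site (d + 1),
            (if toSite r' μ % (P : ℤ) = (P : ℤ) - 1 ∧ u' ν % (P : ℤ) = (P : ℤ) - 1 ∧ x α % (P : ℤ) = (P : ℤ) - 1 ∧ z β % (P : ℤ) = (P : ℤ) - 1 then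
              (c • mmRead Lc (K3OfK (unitK sf sm (coDressKBmAt (toSite r) Lc (KInvStep (d := d) Lc j))) Lc S M
                  (W2SymOfK (unitK sf sm (coDressKBmAt (toSite r) Lc (KInvStep (d := d) Lc j))) Lc S M 0 M₂) μ (toSite r') ν u')
                + cB • B μ (toSite r') ν u') x z (Sum.inl α) (Sum.inl β) else 0)) b₀ a₀ b₀ a₀)
        + ((fun μ ν α β : Fin (d + 1) => ∑ r' ∈ box (d + 1) P, ∑' u' : Site (d + 1), ∑' x : Site (d + 1), ∑' z : Site (d + 1),
            (if toSite r' μ % (P : ℤ) = (P : ℤ) - 1 ∧ u' ν % (P : ℤ) = (P : ℤ) - 1 ∧ x α % (P : ℤ) = (P : ℤ) - 1 ∧ z β % (P : ℤ) = (P : ℤ) - 1 then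
              (c • mmRead Lc (K3OfK (unitK sf sm (coDressKBmAt (toSite r) Lc (KInvStep (d := d) Lc j))) Lc S M
                  (W2SymOfK (unitK sf sm (coDressKBmAt (toSite r) Lc (KInvStep (d := d) Lc j))) Lc S M 0 M₂) μ (toSite r') ν u')
                + cB • B μ (toSite r') ν u') x z (Sum.inl α) (Sum.inl β) else 0)) b₀ a₀ b₀ a₀
          + (fun μ ν α β : Fin (d + 1) => ∑ r' ∈ box (d + 1) P, ∑' u' : Site (d + 1), ∑' x : Site (d + 1), ∑' z : Site (d + 1),
            (if toSite r' μ % (P : ℤ) = (P : ℤ) - 1 ∧ u' ν % (P : ℤ) = (P : ℤ) - 1 ∧ x α % (P : ℤ) = (P : ℤ) - 1 ∧ z β % (P : ℤ) = (P : ℤ) - 1 then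
              (c • mmRead Lc (K3OfK (unitK sf sm (coDressKBmAt (toSite r) Lc (KInvStep (d := d) Lc j))) Lc S M
                  (W2SymOfK (unitK sf sm (coDressKBmAt (toSite r) Lc (KInvStep (d := d) Lc j))) Lc S M 0 M₂) μ (toSite r') ν u')
                + cB • B μ (toSite r') ν u') x z (Sum.inl α) (Sum.inl β) else 0)) a₀ b₀ b₀ a₀))
          = 4 * ((c * -(((sf * sm) * (stepScale d Lc j * (Lc : ℝ) ^ (d + 1))⁻¹) * ((sf * sm) * (stepScale d Lc j * (Lc : ℝ) ^ (d + 1))⁻¹))) * (((sf * sm) * (stepScale d Lc j * (Lc : ℝ) ^ (d + 1))⁻¹) * ((sf * sm) * (stepScale d Lc j * (Lc : ℝ) ^ (d + 1))⁻¹))) * (V₁ + V₂) := by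
  classical
  haveI : NeZero P := ⟨by omega⟩
  haveI : NeZero (Lc * P) := ⟨(Nat.mul_pos (by omega) (by omega)).ne'⟩
  -- the dressed kernel: decay and `Lc`-block periodicity
  obtain ⟨δK, C', hδK, hC', hK'⟩ := decays_coDressKBmAt hLc hr (decays_KInvStep (d := d) (Lc := Lc) j)
  have hKu := decays_unitK (sf := sf) (sm := sm) hK'
  have hCK0 : 0 ≤ max |sf| |sm| * C' * max |sf| |sm| := hKu.nonneg (Sum.inl 0)
  have hXs : ∀ t : Site (d + 1), shiftK (-((Lc : ℤ) • t)) (unitK sf sm (coDressKBmAt (toSite r) Lc (KInvStep (d := d) Lc j)))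
      = unitK sf sm (coDressKBmAt (toSite r) Lc (KInvStep (d := d) Lc j)) := by
    intro t
    show unitK sf sm (shiftK (-((Lc : ℤ) • t)) (coDressKBmAt (toSite r) Lc (KInvStep (d := d) Lc j))) = _
    rw [shiftK_coDressKBmAt (toSite r) hLc (shiftK_KInvStep (d := d) (Lc := Lc) j) t]
  have esmul : ∀ s : Site (d + 1), ((Lc * P : ℕ) : ℤ) • s = (Lc : ℤ) • ((P : ℤ) • s) := by
    intro s; rw [smul_smul, Nat.cast_mul]
  have hXt : ∀ s : Site (d + 1), shiftK (-(((Lc * P : ℕ) : ℤ) • s)) (unitK sf sm (coDressKBmAt (toSite r) Lc (KInvStep (d := d) Lc j)))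
      = unitK sf sm (coDressKBmAt (toSite r) Lc (KInvStep (d := d) Lc j)) := by
    intro s; rw [esmul]; exact hXs ((P : ℤ) • s)
  have hStN : ∀ (κ : Fin (d + 1)) (t s : Site (d + 1)), S κ (t + ((Lc * P : ℕ) : ℤ) • s) = shiftK (-(((Lc * P : ℕ) : ℤ) • s)) (S κ t) := by
    intro κ t s; rw [esmul]; exact hSt κ t ((P : ℤ) • s)
  -- the dressed vertex family and a common rate
  obtain ⟨CD, δD, hδD, hV⟩ := exists_vertexFamily_dM_dressedStep hLc hr sf sm j hS hδs hM hδM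
  have hCs : 0 ≤ Cs := (hS 0 0).nonneg (Sum.inl 0)
  have hCM : 0 ≤ CM := (hM 0 0).nonneg (Sum.inl 0)
  have hCD : 0 ≤ CD := (hV 0 0).nonneg (Sum.inl 0)
  have hC₂ : 0 ≤ C₂ := hM₂.nonneg
  set m₀ : ℝ := min (min (min (min δK δs) δM) δ₂) δD with hm₀
  have hm0 : 0 < m₀ := lt_min (lt_min (lt_min (lt_min hδK hδs) hδM) hδ₂) hδD
  have hKm : Decays (unitK sf sm (coDressKBmAt (toSite r) Lc (KInvStep (d := d) Lc j))) (max |sf| |sm| * C' * max |sf| |sm|) m₀ :=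
    OneStepResolventKernel.decays_mono hKu hCK0 le_rfl
      ((min_le_left _ _).trans ((min_le_left _ _).trans ((min_le_left _ _).trans (min_le_left _ _))))
  have hSm : LocStencil S Cs m₀ :=
    locStencil_mono hS hCs ((min_le_left _ _).trans ((min_le_left _ _).trans ((min_le_left _ _).trans (min_le_right _ _))))
  have hMm : VertexFamily M Lc CM m₀ := BalabanStepW2.vertexFamily_mono' hM hCM ((min_le_left _ _).trans ((min_le_left _ _).trans (min_le_right _ _)))
  have hM₂m : LocStencilFM Lc M₂ C₂ m₀ := locStencilFM_mono hM₂ hC₂ ((min_le_left _ _).trans (min_le_right _ _))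
  have hDm : ∀ (κ : Fin (d + 1)) (u : Site (d + 1)),
      BiLoc (dM (unitK sf sm (coDressKBmAt (toSite r) Lc (KInvStep (d := d) Lc j))) Lc S M κ u) ((Lc : ℤ) • u) ((Lc : ℤ) • u) CD m₀ :=
    fun κ u => biLoc_mono (hV κ u) hCD (min_le_right _ _)
  -- `Loc` of the two dressed letters (Part 47's hypotheses)
  have hb : ∀ (κ : Fin (d + 1)) (y : Site (d + 1)), Loc (dM (unitK sf sm (coDressKBmAt (toSite r) Lc (KInvStep (d := d) Lc j))) Lc S M κ y) :=
    fun κ y => ⟨_, _, _, _, hδD, hV κ y⟩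
  obtain ⟨Cw, δw, hδw, hVW⟩ := vertexFamily₂_W2SymOfK' (N := Lc) ⟨δK, _, hδK, hCK0, hKu⟩ hS hδs hM hδM (WSlotT2OfPieces.locStencil₂_zero (d := d) 1) one_pos hM₂ hδ₂
  have hW : ∀ (κ : Fin (d + 1)) (y : Site (d + 1)) (κ' : Fin (d + 1)) (y' : Site (d + 1)),
      Loc (W2SymOfK (unitK sf sm (coDressKBmAt (toSite r) Lc (KInvStep (d := d) Lc j))) Lc S M 0 M₂ κ y κ' y') :=
    fun κ y κ' y' => ⟨_, _, _, _, hδw, hVW κ y κ' y'⟩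
  -- masks
  have hχ : ∀ s : ℤ, |(fun s : ℤ => if s % (P : ℤ) = (P : ℤ) - 1 then (1 : ℝ) else 0) s| ≤ 1 := by
    intro s; simp only; split_ifs <;> simp
  have hχχ : ∀ (A : Prop) [Decidable A] (ν : Fin (d + 1)) (u' : Site (d + 1)),
      |(fun u' : Site (d + 1) => (if A then (1 : ℝ) else 0) * (if u' ν % (P : ℤ) = (P : ℤ) - 1 then (1 : ℝ) else 0)) u'| ≤ 1 := by
    intro A _ ν u'; simp only; split_ifs <;> simp
  have hmm : ∀ (α β : Fin (d + 1)) (yw : Site (d + 1) × Site (d + 1)),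
      |(fun yw : Site (d + 1) × Site (d + 1) => (if yw.1 α % ((Lc * P : ℕ) : ℤ) = ((Lc * P : ℕ) : ℤ) - 1 then (1 : ℝ) else 0) *
        (if yw.2 β % ((Lc * P : ℕ) : ℤ) = ((Lc * P : ℕ) : ℤ) - 1 then (1 : ℝ) else 0)) yw| ≤ 1 := by
    intro α β yw; simp only; split_ifs <;> simp
  have hLP : (Lc : ℤ) * (P : ℤ) = ((Lc * P : ℕ) : ℤ) := by push_cast; ring
  -- the three-word display (Part 47, split by the free-bond summabilities)
  have hdisp : ∀ μ ν α β : Fin (d + 1),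
      (∑ r' ∈ box (d + 1) P, ∑' u' : Site (d + 1), ∑' x : Site (d + 1), ∑' z : Site (d + 1),
          (if toSite r' μ % (P : ℤ) = (P : ℤ) - 1 ∧ u' ν % (P : ℤ) = (P : ℤ) - 1 ∧ x α % (P : ℤ) = (P : ℤ) - 1 ∧ z β % (P : ℤ) = (P : ℤ) - 1 then
            (c • mmRead Lc (K3OfK (unitK sf sm (coDressKBmAt (toSite r) Lc (KInvStep (d := d) Lc j))) Lc S M
                (W2SymOfK (unitK sf sm (coDressKBmAt (toSite r) Lc (KInvStep (d := d) Lc j))) Lc S M 0 M₂) μ (toSite r') ν u')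
              + cB • B μ (toSite r') ν u') x z (Sum.inl α) (Sum.inl β) else 0))
        = c * -(((sf * sm) * (stepScale d Lc j * (Lc : ℝ) ^ (d + 1))⁻¹) * ((sf * sm) * (stepScale d Lc j * (Lc : ℝ) ^ (d + 1))⁻¹)) *
          ((∑ r' ∈ box (d + 1) P, ∑' u' : Site (d + 1), (if toSite r' μ % (P : ℤ) = (P : ℤ) - 1 then (1 : ℝ) else 0) * (if u' ν % (P : ℤ) = (P : ℤ) - 1 then (1 : ℝ) else 0) *
              ∑' yw : Site (d + 1) × Site (d + 1), ((if yw.1 α % ((Lc * P : ℕ) : ℤ) = ((Lc * P : ℕ) : ℤ) - 1 then (1 : ℝ) else 0) *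
                  (if yw.2 β % ((Lc * P : ℕ) : ℤ) = ((Lc * P : ℕ) : ℤ) - 1 then (1 : ℝ) else 0)) *
                comp (comp (dM (unitK sf sm (coDressKBmAt (toSite r) Lc (KInvStep (d := d) Lc j))) Lc S M μ (toSite r'))
                  (unitK sf sm (coDressKBmAt (toSite r) Lc (KInvStep (d := d) Lc j))))
                  (dM (unitK sf sm (coDressKBmAt (toSite r) Lc (KInvStep (d := d) Lc j))) Lc S M ν u') yw.1 yw.2 (Sum.inl α) (Sum.inl β)) +
           (∑ r' ∈ box (d + 1) P, ∑' u' : Site (d + 1), (if toSite r' μ % (P : ℤ) = (P : ℤ) - 1 then (1 : ℝ) else 0) * (if u' ν % (P : ℤ) = (P : ℤ) - 1 then (1 : ℝ) else 0) *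
              ∑' yw : Site (d + 1) × Site (d + 1), ((if yw.1 α % ((Lc * P : ℕ) : ℤ) = ((Lc * P : ℕ) : ℤ) - 1 then (1 : ℝ) else 0) *
                  (if yw.2 β % ((Lc * P : ℕ) : ℤ) = ((Lc * P : ℕ) : ℤ) - 1 then (1 : ℝ) else 0)) *
                comp (comp (dM (unitK sf sm (coDressKBmAt (toSite r) Lc (KInvStep (d := d) Lc j))) Lc S M ν u')
                  (unitK sf sm (coDressKBmAt (toSite r) Lc (KInvStep (d := d) Lc j))))
                  (dM (unitK sf sm (coDressKBmAt (toSite r) Lc (KInvStep (d := d) Lc j))) Lc S M μ (toSite r')) yw.1 yw.2 (Sum.inl α) (Sum.inl β)) -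
           (∑ r' ∈ box (d + 1) P, ∑' u' : Site (d + 1), (if toSite r' μ % (P : ℤ) = (P : ℤ) - 1 then (1 : ℝ) else 0) * (if u' ν % (P : ℤ) = (P : ℤ) - 1 then (1 : ℝ) else 0) *
              ∑' yw : Site (d + 1) × Site (d + 1), (if yw.1 α % ((Lc * P : ℕ) : ℤ) = ((Lc * P : ℕ) : ℤ) - 1 then (1 : ℝ) else 0) *
                  (if yw.2 β % ((Lc * P : ℕ) : ℤ) = ((Lc * P : ℕ) : ℤ) - 1 then (1 : ℝ) else 0) *
                W2SymOfK (unitK sf sm (coDressKBmAt (toSite r) Lc (KInvStep (d := d) Lc j))) Lc S M 0 M₂ μ (toSite r') ν u' yw.1 yw.2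
                  (Sum.inl α) (Sum.inl β))) := by
    intro μ ν α β
    have h47 := faceRead_dressedSource_inl_inl (d := d) hLc hr hP sf sm j
      (W := W2SymOfK (unitK sf sm (coDressKBmAt (toSite r) Lc (KInvStep (d := d) Lc j))) Lc S M 0 M₂) (B := B) c cB hb hW hBff μ ν α β
    simp only [hLP] at h47
    rw [h47]
    congr 1
    -- free-bond summabilities of the three words
    have Sa : ∀ r' : Fin (d + 1) → ℕ, Summable fun u' : Site (d + 1) =>
        (if toSite r' μ % (P : ℤ) = (P : ℤ) - 1 then (1 : ℝ) else 0) * (if u' ν % (P : ℤ) = (P : ℤ) - 1 then (1 : ℝ) else 0) *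
          ∑' yw : Site (d + 1) × Site (d + 1), ((if yw.1 α % ((Lc * P : ℕ) : ℤ) = ((Lc * P : ℕ) : ℤ) - 1 then (1 : ℝ) else 0) *
              (if yw.2 β % ((Lc * P : ℕ) : ℤ) = ((Lc * P : ℕ) : ℤ) - 1 then (1 : ℝ) else 0)) *
            comp (comp (dM (unitK sf sm (coDressKBmAt (toSite r) Lc (KInvStep (d := d) Lc j))) Lc S M μ (toSite r'))
              (unitK sf sm (coDressKBmAt (toSite r) Lc (KInvStep (d := d) Lc j))))
              (dM (unitK sf sm (coDressKBmAt (toSite r) Lc (KInvStep (d := d) Lc j))) Lc S M ν u') yw.1 yw.2 (Sum.inl α) (Sum.inl β) :=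
      fun r' => summable_word_coarse_right (D := dM (unitK sf sm (coDressKBmAt (toSite r) Lc (KInvStep (d := d) Lc j))) Lc S M) hLc
        (hDm μ (toSite r')) hKm hm0 hDm ν _ (hχχ _ ν) _ (hmm α β) (Sum.inl α) (Sum.inl β)
    have Sb : ∀ r' : Fin (d + 1) → ℕ, Summable fun u' : Site (d + 1) =>
        (if toSite r' μ % (P : ℤ) = (P : ℤ) - 1 then (1 : ℝ) else 0) * (if u' ν % (P : ℤ) = (P : ℤ) - 1 then (1 : ℝ) else 0) *
          ∑' yw : Site (d + 1) × Site (d + 1), ((if yw.1 α % ((Lc * P : ℕ) : ℤ) = ((Lc * P : ℕ) : ℤ) - 1 then (1 : ℝ) else 0) *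
              (if yw.2 β % ((Lc * P : ℕ) : ℤ) = ((Lc * P : ℕ) : ℤ) - 1 then (1 : ℝ) else 0)) *
            comp (comp (dM (unitK sf sm (coDressKBmAt (toSite r) Lc (KInvStep (d := d) Lc j))) Lc S M ν u')
              (unitK sf sm (coDressKBmAt (toSite r) Lc (KInvStep (d := d) Lc j))))
              (dM (unitK sf sm (coDressKBmAt (toSite r) Lc (KInvStep (d := d) Lc j))) Lc S M μ (toSite r')) yw.1 yw.2 (Sum.inl α) (Sum.inl β) :=
      fun r' => summable_word_coarse (D := dM (unitK sf sm (coDressKBmAt (toSite r) Lc (KInvStep (d := d) Lc j))) Lc S M) hLc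
        (hDm μ (toSite r')) hKm hm0 hDm ν _ (hχχ _ ν) _ (hmm α β) (Sum.inl α) (Sum.inl β)
    have Sw : ∀ r' : Fin (d + 1) → ℕ, Summable fun u' : Site (d + 1) =>
        (if toSite r' μ % (P : ℤ) = (P : ℤ) - 1 then (1 : ℝ) else 0) * (if u' ν % (P : ℤ) = (P : ℤ) - 1 then (1 : ℝ) else 0) *
          ∑' yw : Site (d + 1) × Site (d + 1), (if yw.1 α % ((Lc * P : ℕ) : ℤ) = ((Lc * P : ℕ) : ℤ) - 1 then (1 : ℝ) else 0) *
              (if yw.2 β % ((Lc * P : ℕ) : ℤ) = ((Lc * P : ℕ) : ℤ) - 1 then (1 : ℝ) else 0) *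
            W2SymOfK (unitK sf sm (coDressKBmAt (toSite r) Lc (KInvStep (d := d) Lc j))) Lc S M 0 M₂ μ (toSite r') ν u' yw.1 yw.2
              (Sum.inl α) (Sum.inl β) :=
      fun r' => summable_faceWord_W2SymOfK_zero₂ (N := Lc) hLc hKm hCK0 hm0 hSm hMm hM₂m μ (toSite r') ν _ (hχχ _ ν) _ α β (Sum.inl α) (Sum.inl β)
    rw [← Finset.sum_add_distrib, ← Finset.sum_sub_distrib]
    refine Finset.sum_congr rfl fun r' _ => ?_
    rw [← (Sa r').tsum_add (Sb r'), ← ((Sa r').add (Sb r')).tsum_sub (Sw r')]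
    refine tsum_congr fun u' => ?_
    rw [ite_and_three]
  -- the (γ) hand's `CrossedFromThreeWords` fed by the eight value hypotheses
  have h49 := crossed_of_threeWords (d := d) (Lc := Lc) (P := P) (N := Lc * P)
    (X := unitK sf sm (coDressKBmAt (toSite r) Lc (KInvStep (d := d) Lc j)))
    (D := dM (unitK sf sm (coDressKBmAt (toSite r) Lc (KInvStep (d := d) Lc j))) Lc S M) (S := S)
    hLc hKm hXt hm0 hDm (fun κ u s => dM_dressedStep_translate_coarse (r := r) hLc sf sm j P hSt hMt κ u s) hSm hStN
    ((sf * sm) * (stepScale d Lc j * (Lc : ℝ) ^ (d + 1))⁻¹)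
    (fun κ x z a b => tsum_faceBond_dM_dressedStep hLc hr sf sm j κ hP hS hδs hM hδM x z a b)
    (c * -(((sf * sm) * (stepScale d Lc j * (Lc : ℝ) ^ (d + 1))⁻¹) * ((sf * sm) * (stepScale d Lc j * (Lc : ℝ) ^ (d + 1))⁻¹)))
    (F := fun μ ν α β : Fin (d + 1) => ∑ r' ∈ box (d + 1) P, ∑' u' : Site (d + 1), ∑' x : Site (d + 1), ∑' z : Site (d + 1),
      (if toSite r' μ % (P : ℤ) = (P : ℤ) - 1 ∧ u' ν % (P : ℤ) = (P : ℤ) - 1 ∧ x α % (P : ℤ) = (P : ℤ) - 1 ∧ z β % (P : ℤ) = (P : ℤ) - 1 then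
        (c • mmRead Lc (K3OfK (unitK sf sm (coDressKBmAt (toSite r) Lc (KInvStep (d := d) Lc j))) Lc S M
            (W2SymOfK (unitK sf sm (coDressKBmAt (toSite r) Lc (KInvStep (d := d) Lc j))) Lc S M 0 M₂) μ (toSite r') ν u')
          + cB • B μ (toSite r') ν u') x z (Sum.inl α) (Sum.inl β) else 0))
    (Ww := fun μ ν α β : Fin (d + 1) => ∑ r' ∈ box (d + 1) P, ∑' u' : Site (d + 1),
      (if toSite r' μ % (P : ℤ) = (P : ℤ) - 1 then (1 : ℝ) else 0) * (if u' ν % (P : ℤ) = (P : ℤ) - 1 then (1 : ℝ) else 0) *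
        ∑' yw : Site (d + 1) × Site (d + 1), (if yw.1 α % ((Lc * P : ℕ) : ℤ) = ((Lc * P : ℕ) : ℤ) - 1 then (1 : ℝ) else 0) *
            (if yw.2 β % ((Lc * P : ℕ) : ℤ) = ((Lc * P : ℕ) : ℤ) - 1 then (1 : ℝ) else 0) *
          W2SymOfK (unitK sf sm (coDressKBmAt (toSite r) Lc (KInvStep (d := d) Lc j))) Lc S M 0 M₂ μ (toSite r') ν u' yw.1 yw.2
            (Sum.inl α) (Sum.inl β))
    (fun μ ν α β => hdisp μ ν α β)
    (faceWWord_LS_eq_zero (d := d) hLc hr sf sm j (P := P) hS hδs hM hδM hSrow hMrow hM₂ hδ₂ hM₂t (((Lc * P : ℕ) : ℤ)) ⟨1, by push_cast; ring⟩)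
    hD1 hD2 hD3 hD4 hS1 hS2 hS3 hS4
  exact h49

end Summit.QuantumFields.BalabanUV.Beta.GAN24.FaceReadCrossedFromValues

end
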